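import Mathlib
import HarnessLib
import Summits.KontsevichZagierPeriods.Zeta5Search.SorokinLemma3Fibre

/-!
# ζ(5) search — Zudilin's Lemma 3: `J_{k+1}` as a Barnes integral of `J_k` at shifted complex parameters (cell `pub-zeta5`, ct-1 g27)

HONEST FRAMING: systematic search; no irrationality claim unless kernel-certified.  An identity of absolutely convergent integrals
(Fubini); nothing here is an irrationality result, a worthiness exponent or a denominator statement; no named fact is discharged;
no definition is introduced (the complex-parameter integrands are written inline).

Brick B3 of `HOME/ct-1/g26/VWP-BLUEPRINT.md` = Lemma 3 of Zudilin, math/0206177 (0-indexed, `k+1 ≥ 2` variables):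

  `J_{k+1}(a₀; a_0..a_k | b_0..b_k) = Γ(b_k−a_k)/Γ(a₀) · (1/2π) ∫_ℝ Γ(a₀+s)Γ(a_k+s)Γ(−s)/Γ(b_k+s) · e^{iεπs} ·
      J_k(a₀+s; a_0+s..a_{k−1}+s | b_0+s..b_{k−1}+s) dy`,   `s = −t₀+iy`,

`ε = 0` for odd `k` (Zudilin's even `k+1`), `ε = ±1` for even `k` (his `e^{±πit}`), under `0 < t₀ < Re a₀`, `t₀ < Re a_k`,
`Re a₀ + Re a_k < Re b_k`, integrability of the `J_{k+1}`-integrand on `[0,1]^{k+1}` and of the (real, typed) `J_k`-integrand at the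
shifted real parts `(Re a₀ − t₀; Re a_j − t₀ | Re b_j − t₀)` on `[0,1]^k` (Zudilin: "and the integral on the left converges"; the
second condition is what his absolute-convergence remark needs — both are supplied by `SorokinConvergence` /
`SorokinLastVariable.integrableOn_integrand` from corner conditions).

* `measurable_joint`, `norm_phase_le`, `integrable_joint` — the joint integrand `K(y)e^{iεπs}·[J_k-integrand at (a+s)](x')` on
  `[0,1]^k × ℝ` is integrable (majorant = typed real integrand at shifted real parts × `‖K(y)‖e^{π|y|}`,
  `BarnesKernelBounds.integrable_norm_kernel_mul_exp_pi`);
* `lemma3` — the displayed identity (`SorokinLastVariable.setIntegral_succ_eq` + `SorokinLemma3Fibre.fibre_eq` + `integral_integral_swap`).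

Theorems only; imports `Zeta5Search/SorokinLemma3Fibre`.
-/

noncomputable section

namespace Summit.KontsevichZagierPeriods.Zeta5Search.SorokinLemma3

open MeasureTheory Set Filter
open scoped Real
open Literature.NumberTheory.Irrationality.Zudilin2002 (nestedQ sorokinIntegrand)
open Literature.Analysis.SpecialFunctions.Hypergeometric (eulerIntegral)
open Summit.KontsevichZagierPeriods.Zeta5Search.SorokinIntegrandBounds
open Summit.KontsevichZagierPeriods.Zeta5Search.BarnesKernelBounds
open Summit.KontsevichZagierPeriods.Zeta5Search.SorokinLastVariable
open Summit.KontsevichZagierPeriods.Zeta5Search.SorokinLemma3Fibre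

variable {t₀ : ℝ} {a₀ : ℂ} {a b : ℕ → ℂ}

/-! ### 1. The joint integrand on `[0,1]^k × ℝ` -/

/-- Measurability of the joint integrand `(x', y) ↦ K(y) e^{iεπs} · [J_k-integrand at the shifted parameters](x')`. -/
theorem measurable_joint (k : ℕ) (ht₀ : 0 < t₀) (ht₀' : t₀ < a₀.re) (hta : t₀ < (a k).re) (htb : t₀ < (b k).re) (ε : ℝ) :
    Measurable fun p : (Fin k → ℝ) × ℝ =>
      Complex.Gamma (a₀ + (-(t₀ : ℂ) + (p.2 : ℂ) * Complex.I)) * Complex.Gamma (a k + (-(t₀ : ℂ) + (p.2 : ℂ) * Complex.I)) *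
            Complex.Gamma (-(-(t₀ : ℂ) + (p.2 : ℂ) * Complex.I)) /
            Complex.Gamma (b k + (-(t₀ : ℂ) + (p.2 : ℂ) * Complex.I)) *
          Complex.exp (ε * π * Complex.I * (-(t₀ : ℂ) + (p.2 : ℂ) * Complex.I)) *
        ((∏ j : Fin k, ((p.1 j : ℝ) : ℂ) ^ ((a j + (-(t₀ : ℂ) + (p.2 : ℂ) * Complex.I)) - 1) *
            (1 - ((p.1 j : ℝ) : ℂ)) ^ ((b j + (-(t₀ : ℂ) + (p.2 : ℂ) * Complex.I)) - (a j + (-(t₀ : ℂ) + (p.2 : ℂ) * Complex.I)) - 1)) *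
          ((nestedQ (List.ofFn p.1) : ℝ) : ℂ) ^ (-(a₀ + (-(t₀ : ℂ) + (p.2 : ℂ) * Complex.I)))) := by
  have hK : Measurable fun p : (Fin k → ℝ) × ℝ =>
      Complex.Gamma (a₀ + (-(t₀ : ℂ) + (p.2 : ℂ) * Complex.I)) * Complex.Gamma (a k + (-(t₀ : ℂ) + (p.2 : ℂ) * Complex.I)) *
          Complex.Gamma (-(-(t₀ : ℂ) + (p.2 : ℂ) * Complex.I)) /
          Complex.Gamma (b k + (-(t₀ : ℂ) + (p.2 : ℂ) * Complex.I)) :=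
    (continuous_kernel (a₀ := a₀) (a := a k) (b := b k) ht₀ ht₀' hta htb).measurable.comp measurable_snd
  have hs : Measurable fun p : (Fin k → ℝ) × ℝ => -(t₀ : ℂ) + (p.2 : ℂ) * Complex.I := by fun_prop
  have hE : Measurable fun p : (Fin k → ℝ) × ℝ => Complex.exp (ε * π * Complex.I * (-(t₀ : ℂ) + (p.2 : ℂ) * Complex.I)) := by
    fun_prop
  have hQ : Measurable fun p : (Fin k → ℝ) × ℝ => ((nestedQ (List.ofFn p.1) : ℝ) : ℂ) :=
    Complex.measurable_ofReal.comp ((continuous_nestedQ_ofFn k).measurable.comp measurable_fst)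
  refine (hK.mul hE).mul (Measurable.mul (Finset.measurable_prod _ fun j _ => ?_) (hQ.pow (hs.const_add a₀).neg))
  have hj : Measurable fun p : (Fin k → ℝ) × ℝ => ((p.1 j : ℝ) : ℂ) :=
    Complex.measurable_ofReal.comp ((measurable_pi_apply j).comp measurable_fst)
  exact (hj.pow ((hs.const_add (a j)).sub_const 1)).mul
    ((measurable_const.sub hj).pow (((hs.const_add (b j)).sub (hs.const_add (a j))).sub_const 1))

/-- The phase `e^{iεπs}`, `s = −t₀+iy`, `|ε| ≤ 1`, has modulus `e^{−επy} ≤ e^{π|y|}`. -/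
theorem norm_phase_le {ε : ℝ} (hε : |ε| ≤ 1) (t₀ y : ℝ) :
    ‖Complex.exp (ε * π * Complex.I * (-(t₀ : ℂ) + (y : ℂ) * Complex.I))‖ ≤ Real.exp (π * |y|) := by
  rw [Complex.norm_exp]
  apply Real.exp_le_exp.2
  have hre : ((ε : ℂ) * π * Complex.I * (-(t₀ : ℂ) + (y : ℂ) * Complex.I)).re = -(ε * (π * y)) := by
    simp [Complex.mul_re, Complex.mul_im]; ring
  rw [hre]
  calc -(ε * (π * y)) ≤ |ε * (π * y)| := neg_le_abs _
    _ = |ε| * (π * |y|) := by rw [abs_mul, abs_mul, abs_of_pos Real.pi_pos]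
    _ ≤ 1 * (π * |y|) := mul_le_mul_of_nonneg_right hε (by positivity)
    _ = π * |y| := one_mul _

/-- **Integrability of the joint integrand** on `[0,1]^k × ℝ`: dominated by the typed real `J_k`-integrand at the shifted
real parts `(Re a₀ − t₀; Re a_j − t₀ | Re b_j − t₀)` (assumed integrable on `[0,1]^k`) times `‖K(y)‖e^{π|y|}` (integrable when
`Re a₀ + Re a_k < Re b_k`). -/
theorem integrable_joint {k : ℕ} (ht₀ : 0 < t₀) (ht₀' : t₀ < a₀.re) (hta : t₀ < (a k).re)
    (hb : a₀.re + (a k).re < (b k).re) {ε : ℝ} (hε : |ε| ≤ 1)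
    (hJ : IntegrableOn (sorokinIntegrand k (a₀.re - t₀) (fun n => (a n).re - t₀) (fun n => (b n).re - t₀))
      (Set.pi univ fun _ : Fin k => Icc (0 : ℝ) 1) volume) :
    Integrable (fun p : (Fin k → ℝ) × ℝ =>
      Complex.Gamma (a₀ + (-(t₀ : ℂ) + (p.2 : ℂ) * Complex.I)) * Complex.Gamma (a k + (-(t₀ : ℂ) + (p.2 : ℂ) * Complex.I)) *
            Complex.Gamma (-(-(t₀ : ℂ) + (p.2 : ℂ) * Complex.I)) /
            Complex.Gamma (b k + (-(t₀ : ℂ) + (p.2 : ℂ) * Complex.I)) *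
          Complex.exp (ε * π * Complex.I * (-(t₀ : ℂ) + (p.2 : ℂ) * Complex.I)) *
        ((∏ j : Fin k, ((p.1 j : ℝ) : ℂ) ^ ((a j + (-(t₀ : ℂ) + (p.2 : ℂ) * Complex.I)) - 1) *
            (1 - ((p.1 j : ℝ) : ℂ)) ^ ((b j + (-(t₀ : ℂ) + (p.2 : ℂ) * Complex.I)) - (a j + (-(t₀ : ℂ) + (p.2 : ℂ) * Complex.I)) - 1)) *
          ((nestedQ (List.ofFn p.1) : ℝ) : ℂ) ^ (-(a₀ + (-(t₀ : ℂ) + (p.2 : ℂ) * Complex.I)))))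
      (((volume : Measure (Fin k → ℝ)).restrict (Set.pi univ fun _ : Fin k => Icc (0 : ℝ) 1)).prod (volume : Measure ℝ)) := by
  have htb : t₀ < (b k).re := by linarith [lt_trans ht₀ hta]
  -- the product majorant
  have hΨ : Integrable (fun y : ℝ => ‖Complex.Gamma (a₀ + (-(t₀ : ℂ) + (y : ℂ) * Complex.I)) *
        Complex.Gamma (a k + (-(t₀ : ℂ) + (y : ℂ) * Complex.I)) * Complex.Gamma (-(-(t₀ : ℂ) + (y : ℂ) * Complex.I)) /
        Complex.Gamma (b k + (-(t₀ : ℂ) + (y : ℂ) * Complex.I))‖ * Real.exp (π * |y|)) :=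
    integrable_norm_kernel_mul_exp_pi (a₀ := a₀) (a := a k) (b := b k) ht₀ ht₀' hta htb hb
  have hmaj := hJ.mul_prod hΨ
  -- switch the `x'`-measure to the open cube (null difference) to evaluate the norm of the integrand
  have hae : (Set.pi univ fun _ : Fin k => Icc (0 : ℝ) 1) =ᵐ[volume] (Set.pi univ fun _ : Fin k => Ioo (0 : ℝ) 1) := by
    rw [volume_pi]; exact Measure.pi_Ioo_ae_eq_pi_Icc.symm
  refine hmaj.mono' (measurable_joint k ht₀ ht₀' hta htb ε).aestronglyMeasurable ?_
  rw [IntegrableOn, Measure.restrict_congr_set hae] at hJ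
  rw [Measure.restrict_congr_set hae, ← Measure.restrict_univ (μ := (volume : Measure ℝ)), Measure.prod_restrict]
  filter_upwards [ae_restrict_mem ((MeasurableSet.univ_pi fun _ => measurableSet_Ioo).prod MeasurableSet.univ)] with p hp
  have hx : ∀ j, p.1 j ∈ Ioo (0 : ℝ) 1 := fun j => (mem_prod.1 hp).1 j (mem_univ _)
  have hS := norm_integrand k (a₀ + (-(t₀ : ℂ) + (p.2 : ℂ) * Complex.I)) (fun n => a n + (-(t₀ : ℂ) + (p.2 : ℂ) * Complex.I))
    (fun n => b n + (-(t₀ : ℂ) + (p.2 : ℂ) * Complex.I)) hx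
  have e0 : (a₀ + (-(t₀ : ℂ) + (p.2 : ℂ) * Complex.I)).re = a₀.re - t₀ := by simp [sub_eq_add_neg]
  have e1 : (fun n => (a n + (-(t₀ : ℂ) + (p.2 : ℂ) * Complex.I)).re) = fun n => (a n).re - t₀ := by
    funext n; simp [sub_eq_add_neg]
  have e2 : (fun n => (b n + (-(t₀ : ℂ) + (p.2 : ℂ) * Complex.I)).re) = fun n => (b n).re - t₀ := by
    funext n; simp [sub_eq_add_neg]
  rw [e0, e1, e2] at hS
  have hnn : 0 ≤ sorokinIntegrand k (a₀.re - t₀) (fun n => (a n).re - t₀) (fun n => (b n).re - t₀) p.1 := by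
    rw [← hS]; exact norm_nonneg _
  rw [norm_mul, norm_mul, hS]
  calc _ ≤ ‖Complex.Gamma (a₀ + (-(t₀ : ℂ) + (p.2 : ℂ) * Complex.I)) * Complex.Gamma (a k + (-(t₀ : ℂ) + (p.2 : ℂ) * Complex.I)) *
            Complex.Gamma (-(-(t₀ : ℂ) + (p.2 : ℂ) * Complex.I)) /
            Complex.Gamma (b k + (-(t₀ : ℂ) + (p.2 : ℂ) * Complex.I))‖ * Real.exp (π * |p.2|) *
          sorokinIntegrand k (a₀.re - t₀) (fun n => (a n).re - t₀) (fun n => (b n).re - t₀) p.1 :=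
        mul_le_mul_of_nonneg_right (mul_le_mul_of_nonneg_left (norm_phase_le hε t₀ p.2) (norm_nonneg _)) hnn
    _ = _ := by ring

/-! ### 2. Lemma 3 -/

/-- **Zudilin's Lemma 3** [math/0206177, Lemma 3], complex parameters, 0-indexed with `k+1 ≥ 2` variables: for
`0 < t₀ < Re a₀`, `t₀ < Re a_k`, `Re a₀ + Re a_k < Re b_k`, `ε = 0` (odd `k`) resp. `ε = ±1` (even `k`), and provided the
`J_{k+1}`-integrand is integrable on `[0,1]^{k+1}` and the typed `J_k`-integrand at the shifted real parts
`(Re a₀ − t₀; Re a_j − t₀ | Re b_j − t₀)` is integrable on `[0,1]^k`,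
`∫_{[0,1]^{k+1}} ∏ x_j^{a_j−1}(1−x_j)^{b_j−a_j−1} Q_{k+1}^{−a₀} dx
   = Γ(b_k−a_k)/Γ(a₀) · (1/2π) ∫_ℝ Γ(a₀+s)Γ(a_k+s)Γ(−s)/Γ(b_k+s) · e^{iεπs} ·
       (∫_{[0,1]^k} ∏_{j<k} x_j^{a_j+s−1}(1−x_j)^{b_j−a_j−1} Q_k^{−(a₀+s)} dx') dy`, `s = −t₀+iy`. -/
theorem lemma3 {k : ℕ} (hk : 1 ≤ k) (ht₀ : 0 < t₀) (ht₀' : t₀ < a₀.re) (hta : t₀ < (a k).re)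
    (hb : a₀.re + (a k).re < (b k).re) {ε : ℝ} (hε : (Odd k ∧ ε = 0) ∨ (Even k ∧ (ε = 1 ∨ ε = -1)))
    (hF : IntegrableOn (fun x : Fin (k + 1) → ℝ =>
      (∏ j : Fin (k + 1), ((x j : ℝ) : ℂ) ^ (a j - 1) * (1 - ((x j : ℝ) : ℂ)) ^ (b j - a j - 1)) *
        ((nestedQ (List.ofFn x) : ℝ) : ℂ) ^ (-a₀)) (Set.pi univ fun _ : Fin (k + 1) => Icc (0 : ℝ) 1) volume)
    (hJ : IntegrableOn (sorokinIntegrand k (a₀.re - t₀) (fun n => (a n).re - t₀) (fun n => (b n).re - t₀))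
      (Set.pi univ fun _ : Fin k => Icc (0 : ℝ) 1) volume) :
    ∫ x in Set.pi univ (fun _ : Fin (k + 1) => Icc (0 : ℝ) 1),
        (∏ j : Fin (k + 1), ((x j : ℝ) : ℂ) ^ (a j - 1) * (1 - ((x j : ℝ) : ℂ)) ^ (b j - a j - 1)) *
          ((nestedQ (List.ofFn x) : ℝ) : ℂ) ^ (-a₀) =
      Complex.Gamma (b k - a k) / Complex.Gamma a₀ *
        ((1 / (2 * π) : ℂ) * ∫ y : ℝ,
          Complex.Gamma (a₀ + (-(t₀ : ℂ) + (y : ℂ) * Complex.I)) * Complex.Gamma (a k + (-(t₀ : ℂ) + (y : ℂ) * Complex.I)) *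
                Complex.Gamma (-(-(t₀ : ℂ) + (y : ℂ) * Complex.I)) /
                Complex.Gamma (b k + (-(t₀ : ℂ) + (y : ℂ) * Complex.I)) *
              Complex.exp (ε * π * Complex.I * (-(t₀ : ℂ) + (y : ℂ) * Complex.I)) *
            ∫ x' in Set.pi univ (fun _ : Fin k => Icc (0 : ℝ) 1),
              (∏ j : Fin k, ((x' j : ℝ) : ℂ) ^ ((a j + (-(t₀ : ℂ) + (y : ℂ) * Complex.I)) - 1) *
                  (1 - ((x' j : ℝ) : ℂ)) ^ ((b j + (-(t₀ : ℂ) + (y : ℂ) * Complex.I)) - (a j + (-(t₀ : ℂ) + (y : ℂ) * Complex.I)) - 1)) *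
                ((nestedQ (List.ofFn x') : ℝ) : ℂ) ^ (-(a₀ + (-(t₀ : ℂ) + (y : ℂ) * Complex.I)))) := by
  have hεabs : |ε| ≤ 1 := by
    rcases hε with ⟨-, h⟩ | ⟨-, h | h⟩ <;> simp [h]
  -- name the joint integrand
  set H : (Fin k → ℝ) → ℝ → ℂ := fun x' y =>
    Complex.Gamma (a₀ + (-(t₀ : ℂ) + (y : ℂ) * Complex.I)) * Complex.Gamma (a k + (-(t₀ : ℂ) + (y : ℂ) * Complex.I)) *
          Complex.Gamma (-(-(t₀ : ℂ) + (y : ℂ) * Complex.I)) /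
          Complex.Gamma (b k + (-(t₀ : ℂ) + (y : ℂ) * Complex.I)) *
        Complex.exp (ε * π * Complex.I * (-(t₀ : ℂ) + (y : ℂ) * Complex.I)) *
      ((∏ j : Fin k, ((x' j : ℝ) : ℂ) ^ ((a j + (-(t₀ : ℂ) + (y : ℂ) * Complex.I)) - 1) *
          (1 - ((x' j : ℝ) : ℂ)) ^ ((b j + (-(t₀ : ℂ) + (y : ℂ) * Complex.I)) - (a j + (-(t₀ : ℂ) + (y : ℂ) * Complex.I)) - 1)) *
        ((nestedQ (List.ofFn x') : ℝ) : ℂ) ^ (-(a₀ + (-(t₀ : ℂ) + (y : ℂ) * Complex.I)))) with hHdef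
  have hHint : Integrable (Function.uncurry H)
      (((volume : Measure (Fin k → ℝ)).restrict (Set.pi univ fun _ : Fin k => Icc (0 : ℝ) 1)).prod (volume : Measure ℝ)) := by
    rw [hHdef]
    exact integrable_joint ht₀ ht₀' hta hb hεabs hJ
  -- (1) split off the last variable
  rw [setIntegral_succ_eq hk a₀ a b hF]
  -- (2) fibrewise: the Euler integral as a Barnes integral (a.e. `x'`, on the open cube)
  have hae : (Set.pi univ fun _ : Fin k => Icc (0 : ℝ) 1) =ᵐ[volume] (Set.pi univ fun _ : Fin k => Ioo (0 : ℝ) 1) := by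
    rw [volume_pi]; exact Measure.pi_Ioo_ae_eq_pi_Icc.symm
  have hopen : ∀ᵐ x' ∂((volume : Measure (Fin k → ℝ)).restrict (Set.pi univ fun _ : Fin k => Icc (0 : ℝ) 1)),
      ∀ j, x' j ∈ Ioo (0 : ℝ) 1 := by
    rw [Measure.restrict_congr_set hae]
    filter_upwards [ae_restrict_mem (MeasurableSet.univ_pi fun _ => measurableSet_Ioo)] with x hx
    exact fun j => hx j (mem_univ _)
  have hfibre : ∀ᵐ x' ∂((volume : Measure (Fin k → ℝ)).restrict (Set.pi univ fun _ : Fin k => Icc (0 : ℝ) 1)),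
      (∏ j : Fin k, ((x' j : ℝ) : ℂ) ^ (a j - 1) * (1 - ((x' j : ℝ) : ℂ)) ^ (b j - a j - 1)) *
            ((nestedQ (List.ofFn x') : ℝ) : ℂ) ^ (-a₀) *
          eulerIntegral a₀ (a k) (b k) ((((-1) ^ k * (∏ j, x' j) / nestedQ (List.ofFn x') : ℝ)) : ℂ) =
        Complex.Gamma (b k - a k) / Complex.Gamma a₀ * ((1 / (2 * π) : ℂ) * ∫ y : ℝ, H x' y) := by
    filter_upwards [hopen] with x' hx'
    rw [hHdef]
    exact fibre_eq hk ht₀ ht₀' hta hb hx' hε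
  rw [integral_congr_ae hfibre, integral_const_mul, integral_const_mul]
  -- (3) swap the `x'`- and `y`-integrals
  rw [integral_integral_swap hHint]
  -- (4) pull the `y`-factors out of the inner `x'`-integral
  congr 2
  refine integral_congr_ae (Eventually.of_forall fun y => ?_)
  rw [hHdef]
  simp only
  rw [← integral_const_mul]

end Summit.KontsevichZagierPeriods.Zeta5Search.SorokinLemma3

end
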